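import Summits.BirchSwinnertonDyer.BirchSwinnertonDyer.Theorems.ResidualThetaTransportAtTwoHeckeThetaPartnerAdicAtTwoThetaCosetIdeal
import Literature.NumberTheory.ModularForms.BinaryThetaHigherWeightCoset
import Literature.Analysis.SpecialFunctions.RiemannThetaLineDerivatives
import HarnessLib

/-!
# Coset theta series of an ideal class at weight `n + 1`: `q`-series and the law on `Γ₀(|d_K|·N𝔪)`
# (toward X_k for `Ribet1977_cmNewform_gamma0_of_isGrossencharakter`, stmt-BirchSwinnertonDyer-24141)

Order-`n` analogue of `…ThetaCosetIdeal` (the case `n = 1`).  THEOREMS ONLY.  Prepared by the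
literature-prover seat `bsd-input-ribet77-cm-newform-g0` as EVIDENCE (Summit `Theorems/` is prover-only);
compiles against the tree of 2026-08-28.

`K` imaginary quadratic, `σ : K → ℂ`, `𝔟 = 𝔞𝔪` with Gram data `(b, B)` (`ThetaGram.exists_gram`),
`M = N𝔪`, `x₀ ∈ 𝔞` with coordinates `k` of `M x₀`, `u = (σ bᵢ)ᵢ`.  The order-`n` coset theta is
`Θₙ(τ; x₀ + 𝔟) = ∂ⁿ_s ϑ[k/M; 0](s u, (Mτ)·B)|₀`.

* `dotProduct_adjugate_embedding_eq_zero` — `ᵗu (adj B) u = 0` (the linear form `σ` is isotropic for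
  the adjugate of the Gram matrix of the norm form: `σ(x)ⁿ` is a spherical polynomial);
* `hasSum_iteratedDeriv_thetaCoset` — `Θₙ(τ; x₀ + 𝔟) = Σ_m (2πi σ(x₀ + x_m))ⁿ q^{N((x₀+x_m))/N𝔞}`;
* `iteratedDeriv_thetaCoset_eq_zero_of_mem` — `Θₙ(τ; 𝔟) = 0` for ODD `n`;
* `iteratedDeriv_thetaCoset_apply_moeb` — for `γ = (a b; c d)`, `|d_K|·M ∣ c`:
  `Θₙ(γτ; d x₀ + 𝔟) = κ(d) (cτ+d)^{n+1} Θₙ(τ; x₀ + 𝔟)`.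

BSD is not proved by this file.
-/

set_option autoImplicit false
set_option linter.dupNamespace false

noncomputable section

open scoped NumberField ComplexConjugate Real MatrixGroups UpperHalfPlane
open NumberField Module Matrix Complex Filter

namespace Summit.BirchSwinnertonDyer.BirchSwinnertonDyer.Theorems.HeckeTheta

open Literature.Analysis.SpecialFunctions
open Literature.NumberTheory.ModularForms.BinaryTheta
open Literature.NumberTheory.Automorphic (siegelUpperHalfSpace mem_siegelUpperHalfSpace_iff)

variable {K : Type} [Field K] [NumberField K]

/-! ### Isotropy of `u = (σ bᵢ)ᵢ` for `adj B` -/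

/-- **`ᵗu (adj B) u = 0`** for `u = (σ bᵢ)ᵢ` and the Gram matrix `B` with
`B_{ij} N𝔟 = σbᵢ σ̄bⱼ + σ̄bᵢ σbⱼ`. -/
theorem dotProduct_adjugate_embedding_eq_zero (σ : K →+* ℂ) {𝔟 : Ideal (𝓞 K)} (b : Basis (Fin 2) ℤ 𝔟)
    {B : Matrix (Fin 2) (Fin 2) ℤ}
    (hB : ∀ i j, ((B i j : ℤ) : ℂ) * ((Ideal.absNorm 𝔟 : ℕ) : ℂ) =
      σ ((b i : 𝓞 K) : K) * conj (σ ((b j : 𝓞 K) : K)) + conj (σ ((b i : 𝓞 K) : K)) * σ ((b j : 𝓞 K) : K))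
    (hN : Ideal.absNorm 𝔟 ≠ 0) :
    (fun i => σ ((b i : 𝓞 K) : K)) ⬝ᵥ ((B.map ((↑) : ℤ → ℂ)).adjugate *ᵥ fun i => σ ((b i : 𝓞 K) : K)) = 0 := by
  have hN' : ((Ideal.absNorm 𝔟 : ℕ) : ℂ) ≠ 0 := by exact_mod_cast hN
  have key : ((fun i => σ ((b i : 𝓞 K) : K)) ⬝ᵥ
      ((B.map ((↑) : ℤ → ℂ)).adjugate *ᵥ fun i => σ ((b i : 𝓞 K) : K))) * ((Ideal.absNorm 𝔟 : ℕ) : ℂ) = 0 := by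
    rw [Matrix.adjugate_fin_two]
    simp only [dotProduct, Matrix.mulVec, Fin.sum_univ_two, Matrix.of_apply, Matrix.map_apply,
      Matrix.cons_val', Matrix.cons_val_zero, Matrix.cons_val_one, Matrix.empty_val',
      Matrix.cons_val_fin_one]
    have e00 := hB 0 0
    have e01 := hB 0 1
    have e10 := hB 1 0
    have e11 := hB 1 1
    linear_combination (σ ((b 0 : 𝓞 K) : K) * σ ((b 0 : 𝓞 K) : K)) * e11
      - (σ ((b 0 : 𝓞 K) : K) * σ ((b 1 : 𝓞 K) : K)) * e01
      - (σ ((b 1 : 𝓞 K) : K) * σ ((b 0 : 𝓞 K) : K)) * e10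
      + (σ ((b 1 : 𝓞 K) : K) * σ ((b 1 : 𝓞 K) : K)) * e00
  exact (mul_eq_zero.mp key).resolve_right hN'

/-! ### The order-`n` coset theta as a `q`-series -/

/-- **`Θₙ(τ; x₀ + 𝔟) = Σ_{m ∈ ℤ²} (2πi σ(x₀ + x_m))ⁿ q^{N((x₀ + x_m))/N𝔞}`**, `u = (σ bᵢ)ᵢ`, `Im τ > 0`. -/
theorem hasSum_iteratedDeriv_thetaCoset (hK : finrank ℚ K = 2) [IsTotallyComplex K] (σ : K →+* ℂ)
    {𝔞 𝔪 𝔟 : Ideal (𝓞 K)} (h𝔟 : 𝔟 = 𝔞 * 𝔪) (h𝔞 : 𝔞 ≠ ⊥) (h𝔪 : 𝔪 ≠ ⊥) (b : Basis (Fin 2) ℤ 𝔟)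
    {B : Matrix (Fin 2) (Fin 2) ℤ}
    (hB : ∀ i j, ((B i j : ℤ) : ℂ) * ((Ideal.absNorm 𝔟 : ℕ) : ℂ) =
      σ ((b i : 𝓞 K) : K) * conj (σ ((b j : 𝓞 K) : K)) + conj (σ ((b i : 𝓞 K) : K)) * σ ((b j : 𝓞 K) : K))
    (hsymm : B.IsSymm) (hpos : (B.map (Int.cast : ℤ → ℝ)).PosDef)
    {x₀ : 𝓞 K} (hx₀ : x₀ ∈ 𝔞) {k : Fin 2 → ℤ}
    (hk : ((b.equivFun.symm k : 𝔟) : 𝓞 K) = (Ideal.absNorm 𝔪 : 𝓞 K) * x₀) (n : ℕ) {τ : ℂ} (hτ : 0 < τ.im) :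
    HasSum (fun m : Fin 2 → ℤ =>
        (2 * π * I * σ ((x₀ : K) + (((b.equivFun.symm m : 𝔟) : 𝓞 K) : K))) ^ n *
          cexp (2 * π * I * τ) ^
            (Ideal.absNorm (Ideal.span {x₀ + ((b.equivFun.symm m : 𝔟) : 𝓞 K)}) / Ideal.absNorm 𝔞))
      (iteratedDeriv n (fun s : ℂ => riemannThetaChar (fun i => (k i : ℂ) / (Ideal.absNorm 𝔪 : ℕ)) 0
          ((((Ideal.absNorm 𝔪 : ℕ) : ℂ) * τ) • B.map ((↑) : ℤ → ℂ)) (s • fun i => σ ((b i : 𝓞 K) : K))) 0) := by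
  have hM : Ideal.absNorm 𝔪 ≠ 0 := by rw [Ne, Ideal.absNorm_eq_zero_iff]; exact h𝔪
  have hτ' : 0 < ((((Ideal.absNorm 𝔪 : ℕ) : ℂ) * τ)).im := by
    rw [Complex.mul_im, Complex.natCast_re, Complex.natCast_im, zero_mul, add_zero]
    exact mul_pos (by exact_mod_cast Nat.pos_of_ne_zero hM) hτ
  have hZ := smul_mem_siegelUpperHalfSpace hsymm hpos hτ'
  obtain ⟨c, hc, hY⟩ := exists_pos_mul_sum_sq_le_of_posDef_im _ hZ.2
  have hZs : ∀ i j, (((((Ideal.absNorm 𝔪 : ℕ) : ℂ) * τ)) • B.map ((↑) : ℤ → ℂ)) i j =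
      (((((Ideal.absNorm 𝔪 : ℕ) : ℂ) * τ)) • B.map ((↑) : ℤ → ℂ)) j i :=
    fun i j => (hZ.1.apply i j).symm
  have h := hasSum_iteratedDeriv_riemannThetaChar_line _ hZs hc hY
    (fun i => (k i : ℂ) / (Ideal.absNorm 𝔪 : ℕ)) 0 (fun i => σ ((b i : 𝓞 K) : K)) n
  refine h.congr_fun fun m => ?_
  have hlin : (∑ i, ((m i : ℂ) + (k i : ℂ) / (Ideal.absNorm 𝔪 : ℕ)) * σ ((b i : 𝓞 K) : K)) =
      (((fun i => (m i : ℂ)) + fun i => (k i : ℂ) / (Ideal.absNorm 𝔪 : ℕ)) ⬝ᵥ fun i => σ ((b i : 𝓞 K) : K)) := by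
    simp only [dotProduct, Pi.add_apply]
  rw [hlin, riemannThetaCharTerm_coset_eq_pow hK σ h𝔟 h𝔞 h𝔪 b hB hx₀ hk τ m,
    dotProduct_coset_eq_embedding σ b hM hk m]

/-! ### Vanishing on the trivial coset (odd `n`) -/

omit [NumberField K] in
/-- **`Θₙ(τ; 𝔟) = 0` for odd `n`**: if `x₀ ∈ 𝔟` its characteristic `k/M` is integral,
`ϑ[k/M; 0] = ϑ[0; 0]` is even, and the odd line derivatives of an even function vanish at `0`. -/
theorem iteratedDeriv_thetaCoset_eq_zero_of_mem {𝔟 : Ideal (𝓞 K)} (b : Basis (Fin 2) ℤ 𝔟)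
    (B : Matrix (Fin 2) (Fin 2) ℤ) {M : ℕ} (hM : M ≠ 0) {x₀ : 𝓞 K} (hx₀ : x₀ ∈ 𝔟) {k : Fin 2 → ℤ}
    (hk : ((b.equivFun.symm k : 𝔟) : 𝓞 K) = (M : 𝓞 K) * x₀) (τ : ℂ) (u : Fin 2 → ℂ) {n : ℕ}
    (hn : Odd n) :
    iteratedDeriv n (fun s : ℂ => riemannThetaChar (fun i => (k i : ℂ) / M) 0 (τ • B.map ((↑) : ℤ → ℂ))
      (s • u)) 0 = 0 := by
  have hk0 : ((b.equivFun.symm 0 : 𝔟) : 𝓞 K) = (M : 𝓞 K) * 0 := by simp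
  have hy : x₀ - 0 ∈ 𝔟 := by rw [sub_zero]; exact hx₀
  have hfun : (fun s : ℂ => riemannThetaChar (fun i => (k i : ℂ) / M) 0 (τ • B.map ((↑) : ℤ → ℂ)) (s • u)) =
      fun s : ℂ => riemannThetaChar 0 0 (τ • B.map ((↑) : ℤ → ℂ)) (s • u) := by
    funext s
    rw [riemannThetaChar_coset_eq_of_sub_mem b hM hk0 hk hy]
    congr 1
    funext i; simp
  rw [hfun]
  exact iteratedDeriv_riemannThetaChar_zero_zero_line_eq_zero _ u hn

/-! ### The law on `Γ₀(|d_K|·M)` -/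

/-- **The weight-`(n+1)` law of the order-`n` coset theta of an ideal class.**  `K` imaginary quadratic
with Kronecker character `κ` (primitive, odd, `κ² = 1`, `ζ_K = ζ·L(κ)`), `𝔟 = 𝔞𝔪` with Gram data
`(b, B)` (`det B = |d_K|`), `M = N𝔪`, `x₀ ∈ 𝔞` with coordinates `k` of `M x₀`, `u = (σ bᵢ)ᵢ`.  For
`γ = (a b; c d) ∈ SL₂(ℤ)` with `|d_K|·M ∣ c`:
`∂ⁿ_s ϑ[d·k/M; 0](s u, (M·γτ)·B)|₀ = κ(d) (cτ+d)^{n+1} ∂ⁿ_s ϑ[k/M; 0](s u, (Mτ)·B)|₀`. -/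
theorem iteratedDeriv_thetaCoset_apply_moeb (hK : finrank ℚ K = 2) [IsTotallyComplex K] (σ : K →+* ℂ)
    {κ : DirichletCharacter ℂ (discr K).natAbs} (hprim : κ.IsPrimitive) (hodd : κ.Odd)
    (hquad : κ ^ 2 = 1)
    (hζ : ∀ s : ℂ, 1 < s.re → NumberField.dedekindZeta K s = riemannZeta s * LSeries (fun n => κ n) s)
    {𝔞 𝔪 𝔟 : Ideal (𝓞 K)} (h𝔟 : 𝔟 = 𝔞 * 𝔪) (h𝔞 : 𝔞 ≠ ⊥) (h𝔪 : 𝔪 ≠ ⊥) (b : Basis (Fin 2) ℤ 𝔟)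
    {B : Matrix (Fin 2) (Fin 2) ℤ}
    (hB : ∀ i j, ((B i j : ℤ) : ℂ) * ((Ideal.absNorm 𝔟 : ℕ) : ℂ) =
      σ ((b i : 𝓞 K) : K) * conj (σ ((b j : 𝓞 K) : K)) + conj (σ ((b i : 𝓞 K) : K)) * σ ((b j : 𝓞 K) : K))
    (hsymm : B.IsSymm) (h00 : Even (B 0 0)) (h11 : Even (B 1 1))
    (hdet : B.det = ((discr K).natAbs : ℤ)) (hpos : (B.map (Int.cast : ℤ → ℝ)).PosDef)
    {x₀ : 𝓞 K} (hx₀ : x₀ ∈ 𝔞) {k : Fin 2 → ℤ}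
    (hk : ((b.equivFun.symm k : 𝔟) : 𝓞 K) = (Ideal.absNorm 𝔪 : 𝓞 K) * x₀)
    {γ : SL(2, ℤ)} (hγ : (((discr K).natAbs * Ideal.absNorm 𝔪 : ℕ) : ℤ) ∣ (γ 1 0 : ℤ)) (n : ℕ) (τ : ℍ) :
    iteratedDeriv n (fun s : ℂ => riemannThetaChar
        (fun i => ((γ 1 1 : ℤ) : ℂ) * ((k i : ℂ) / (Ideal.absNorm 𝔪 : ℕ))) 0
        ((((Ideal.absNorm 𝔪 : ℕ) : ℂ) * ((γ • τ : ℍ) : ℂ)) • B.map ((↑) : ℤ → ℂ))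
        (s • fun i => σ ((b i : 𝓞 K) : K))) 0 =
      κ ((γ 1 1 : ℤ) : ZMod (discr K).natAbs) *
        (((γ 1 0 : ℤ) : ℂ) * (τ : ℂ) + ((γ 1 1 : ℤ) : ℂ)) ^ (n + 1) *
        iteratedDeriv n (fun s : ℂ => riemannThetaChar (fun i => (k i : ℂ) / (Ideal.absNorm 𝔪 : ℕ)) 0
          ((((Ideal.absNorm 𝔪 : ℕ) : ℂ) * (τ : ℂ)) • B.map ((↑) : ℤ → ℂ))
          (s • fun i => σ ((b i : 𝓞 K) : K))) 0 := by
  set M : ℕ := Ideal.absNorm 𝔪 with hMdef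
  have hM : M ≠ 0 := by rw [hMdef, Ne, Ideal.absNorm_eq_zero_iff]; exact h𝔪
  have hMpos : 0 < M := Nat.pos_of_ne_zero hM
  have h𝔟0 : 𝔟 ≠ ⊥ := by rw [h𝔟]; exact mul_ne_zero h𝔞 h𝔪
  have hN𝔟 : Ideal.absNorm 𝔟 ≠ 0 := by rw [Ne, Ideal.absNorm_eq_zero_iff]; exact h𝔟0
  haveI : NeZero (discr K).natAbs := ⟨Int.natAbs_ne_zero.mpr (NumberField.discr_ne_zero K)⟩
  -- the lift `γ'`
  have hMc : (M : ℤ) ∣ (γ 1 0 : ℤ) :=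
    dvd_trans ⟨((discr K).natAbs : ℤ), by push_cast; ring⟩ hγ
  obtain ⟨γ', h00', h01', h10', h11'⟩ := exists_levelLift M γ hMc
  have hγ'D : ((discr K).natAbs : ℤ) ∣ (γ' 1 0 : ℤ) := by
    have h : ((discr K).natAbs : ℤ) * (M : ℤ) ∣ (γ' 1 0 : ℤ) * (M : ℤ) := by
      rw [h10']; exact_mod_cast hγ
    exact Int.dvd_of_mul_dvd_mul_right (by exact_mod_cast hM) h
  have hγ'B : B.det ∣ (γ' 1 0 : ℤ) := by rw [hdet]; exact hγ'D
  -- the unit of the genus-two law, pinned by the Kronecker character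
  obtain ⟨Λ, _, hfull, hnull⟩ :=
    exists_unit_riemannThetaChar_zero_transform hsymm h00 h11 hpos hγ'B
  have hΛκ : Λ = κ ((γ' 1 1 : ℤ) : ZMod (discr K).natAbs) :=
    binaryTheta_unit_eq_kronecker hK σ (D := (discr K).natAbs) (dvd_refl _) hprim hodd hquad hζ
      h𝔟0 b hB hsymm hpos (γ := γ') hγ'D
      (fun τ => by rw [coe_sl_smul]; exact riemannThetaChar_zero_smul_transform hnull τ.im_pos)
  -- the matrix-level law along the isotropic line `u`
  have hu := dotProduct_adjugate_embedding_eq_zero σ b hB hN𝔟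
  rw [iteratedDeriv_thetaCoset_smul hsymm h00 h11 hpos hMpos h00' h01' h10' h11' hγ'B hfull k hu n τ,
    hΛκ, h11']
  -- the phase is trivial
  have hph : cexp (π * I * (((γ 0 1 : ℤ) : ℂ) * ((γ 1 1 : ℤ) : ℂ) * ((k ⬝ᵥ (B *ᵥ k) : ℤ) : ℂ) / M)) = 1 := by
    obtain ⟨n', hn'⟩ : ∃ n' : ℕ, n' = Ideal.absNorm (Ideal.span {x₀}) / Ideal.absNorm 𝔞 := ⟨_, rfl⟩
    rw [dotProduct_mulVec_coords hK σ h𝔟 h𝔞 h𝔪 b hB hx₀ hk, ← hn']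
    have hM' : (M : ℂ) ≠ 0 := by exact_mod_cast hM
    have hcast : (((2 * (Ideal.absNorm 𝔪 : ℤ) * (n' : ℤ) : ℤ)) : ℂ) = 2 * (M : ℂ) * (n' : ℂ) := by
      rw [hMdef]; push_cast; ring
    rw [hcast, show π * I * (((γ 0 1 : ℤ) : ℂ) * ((γ 1 1 : ℤ) : ℂ) * (2 * (M : ℂ) * (n' : ℂ)) / M) =
        (((γ 0 1 : ℤ) * (γ 1 1 : ℤ) * (n' : ℤ) : ℤ) : ℂ) * (2 * π * I) by push_cast; field_simp]
    exact Complex.exp_int_mul_two_pi_mul_I _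
  rw [hph, mul_one]

end Summit.BirchSwinnertonDyer.BirchSwinnertonDyer.Theorems.HeckeTheta

end
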